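import Summits.CriticalPhenomena.PercolationContinuityZ3.Theorems.PercNearOneGluingNoHeavyLowerTailSahiOneStepThresholdStep
import HarnessLib

/-!
# One-step scheme: the FREE-COORDINATE IDENTITY — a counted coordinate outside the support costs exactly a layer covariance

Prover prim-ineq-prove-3 gen 39 (`--supports stmt-CriticalPhenomena-4575`; memo
`run/shared/lean/prim/prim-ineq-prove-3/FINDING-G39-WINDOW.md` §7.4).  No definitions, no sorries.

If neither `A` nor `B` depends on the coordinate `e` (their two sections at `e` coincide with themselves), the degree-3 pivot expansion
`osN_ind_ind_pivot_eq` (gen 19) collapses to an exact two-level MIXTURE formula with one correction term: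
* `osN_free_coordinate_eq` — for an ARBITRARY first event `H` with sections `H¹ ⊇ H⁰` at `e` and the "band" `S = H¹ ∖ H⁰`:
  `n(H;A,B) = p_e·n(H¹;A,B) + q_e·n(H⁰;A,B) + p_e q_e·[μ(S)·μ(S∩A∩B) − μ(S∩A)·μ(S∩B)]`;
* `osN_threshold_free_coordinate_eq` — for the threshold slot `{N_{insert e F} ≥ t+1}` (`e ∉ F`) the band is the LAYER `{N_F = t}`:
  `n_{N_{insert e F} ≥ t+1}(A,B) = p_e·n_{N_F ≥ t}(A,B) + q_e·n_{N_F ≥ t+1}(A,B) + p_e q_e·σ²·Cov(1_A, 1_B ∣ N_F = t)`, `σ = μ{N_F = t}`.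
So a coordinate that is COUNTED by the slot but FREE for both events costs exactly the (typically negative) layer-conditioned covariance of the
pair, to be paid from the mixture of the two adjacent-level `(2′)` values; minimising over `p_e`, `(2′)` with one free counted coordinate is
EQUIVALENT to the LAYER COVARIANCE LEMMA `σ_s²·max(0, −Cov(A,B ∣ N=s)) ≤ (√n_{s+1}(A,B) + √n_s(A,B))²`, which is tight (dictator pairs) and has no
counterexample in 5.5·10⁵ exact tests (memo §7.4).  This identity is the algebraic reason why every one-partner pivot certificate (gen 27 X∧Ψ, the
gen-39 window, the layer-level and two-coordinate piece LPs) dies near free or nearly-free counted coordinates (memo §0(v),(ix)).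
-/

noncomputable section

namespace Summit.CriticalPhenomena.PercolationContinuityZ3.Theorems

namespace SahiOneStep

open MeasureTheory Finset
open Literature.Probability.LatticeModels (prodBernoulli)
open Literature.Probability.Percolation.DecisionTree (ind)
open scoped Classical

variable {ι : Type*} [Fintype ι]

/-- **FREE-COORDINATE IDENTITY (arbitrary first event).**  If the sections of `A` and of `B` at `e` are `A` and `B` themselves (neither event
depends on `e`) and the sections `H¹ ⊇ H⁰` of `H` are nested, then
`n(H;A,B) = p·n(H¹;A,B) + q·n(H⁰;A,B) + pq·[μ(H¹∖H⁰)·μ((H¹∖H⁰)∩A∩B) − μ((H¹∖H⁰)∩A)·μ((H¹∖H⁰)∩B)]`. [this work] -/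
theorem osN_free_coordinate_eq (p : ι → unitInterval) (H A B : Set (Set ι)) (e : ι)
    (hA1 : {ω : Set ι | insert e ω ∈ A} = A) (hA0 : {ω : Set ι | ω \ {e} ∈ A} = A)
    (hB1 : {ω : Set ι | insert e ω ∈ B} = B) (hB0 : {ω : Set ι | ω \ {e} ∈ B} = B)
    (hH : {ω : Set ι | ω \ {e} ∈ H} ⊆ {ω : Set ι | insert e ω ∈ H}) :
    osN p H (ind A) (ind B) =
      (p e : ℝ) * osN p {ω : Set ι | insert e ω ∈ H} (ind A) (ind B)
        + (1 - p e) * osN p {ω : Set ι | ω \ {e} ∈ H} (ind A) (ind B)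
        + (p e : ℝ) * (1 - p e) *
          ((prodBernoulli p).real ({ω : Set ι | insert e ω ∈ H} \ {ω : Set ι | ω \ {e} ∈ H}) *
              (prodBernoulli p).real (({ω : Set ι | insert e ω ∈ H} \ {ω : Set ι | ω \ {e} ∈ H}) ∩ A ∩ B)
            - (prodBernoulli p).real (({ω : Set ι | insert e ω ∈ H} \ {ω : Set ι | ω \ {e} ∈ H}) ∩ A)
              * (prodBernoulli p).real (({ω : Set ι | insert e ω ∈ H} \ {ω : Set ι | ω \ {e} ∈ H}) ∩ B)) := by
  rw [osN_ind_ind_pivot_eq p H A B e, hA1, hA0, hB1, hB0, osN_ind_ind, osN_ind_ind]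
  -- band pieces: μ(S ∩ X) = μ(H¹ ∩ X) − μ(H⁰ ∩ X) for S = H¹ ∖ H⁰ (H⁰ ⊆ H¹)
  have band : ∀ X : Set (Set ι),
      (prodBernoulli p).real (({ω : Set ι | insert e ω ∈ H} \ {ω : Set ι | ω \ {e} ∈ H}) ∩ X) =
        (prodBernoulli p).real ({ω : Set ι | insert e ω ∈ H} ∩ X) - (prodBernoulli p).real ({ω : Set ι | ω \ {e} ∈ H} ∩ X) := fun X => by
    have h := measureReal_inter_add_sdiff (μ := prodBernoulli p) (s := {ω : Set ι | insert e ω ∈ H} ∩ X)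
      (t := {ω : Set ι | ω \ {e} ∈ H}) MeasurableSet.of_discrete
    have e1 : ({ω : Set ι | insert e ω ∈ H} ∩ X) ∩ {ω : Set ι | ω \ {e} ∈ H} = {ω : Set ι | ω \ {e} ∈ H} ∩ X := by
      ext ω; simp only [Set.mem_inter_iff]; constructor
      · rintro ⟨⟨_, hx⟩, h0⟩; exact ⟨h0, hx⟩
      · rintro ⟨h0, hx⟩; exact ⟨⟨hH h0, hx⟩, h0⟩
    have e2 : ({ω : Set ι | insert e ω ∈ H} ∩ X) \ {ω : Set ι | ω \ {e} ∈ H} = ({ω : Set ι | insert e ω ∈ H} \ {ω : Set ι | ω \ {e} ∈ H}) ∩ X := by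
      ext ω; simp only [Set.mem_inter_iff, Set.mem_sdiff]; tauto
    rw [e1, e2] at h; linarith
  have bandU : (prodBernoulli p).real ({ω : Set ι | insert e ω ∈ H} \ {ω : Set ι | ω \ {e} ∈ H}) =
      (prodBernoulli p).real {ω : Set ι | insert e ω ∈ H} - (prodBernoulli p).real {ω : Set ι | ω \ {e} ∈ H} := by
    have h := band Set.univ; simp only [Set.inter_univ] at h; exact h
  rw [bandU, Set.inter_assoc ({ω : Set ι | insert e ω ∈ H} \ {ω : Set ι | ω \ {e} ∈ H}) A B, band (A ∩ B), band A, band B,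
    ← Set.inter_assoc, ← Set.inter_assoc]
  ring

omit [Fintype ι] in
/-- Counting in `insert e F` on the band: for `e ∉ F`, the inner minus the outer section of the threshold slot `{N_{insert e F} ≥ t+1}` is the
layer `{N_F = t}` (as a measure identity on intersections). [folklore] -/
theorem real_section_band_eq_layer (p : ι → unitInterval) {F : Finset ι} {e : ι} (he : e ∉ F) (t : ℕ) (X : Set (Set ι)) :
    (prodBernoulli p).real
        (({ω : Set ι | insert e ω ∈ {ω : Set ι | t + 1 ≤ ((insert e F).filter (· ∈ ω)).card}} \
            {ω : Set ι | ω \ {e} ∈ {ω : Set ι | t + 1 ≤ ((insert e F).filter (· ∈ ω)).card}}) ∩ X) =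
      (prodBernoulli p).real ({ω : Set ι | (F.filter (· ∈ ω)).card = t} ∩ X) := by
  rw [section_insert_threshold he t, section_sdiff_threshold he t]
  congr 1
  ext ω
  simp only [Set.mem_inter_iff, Set.mem_sdiff, Set.mem_setOf_eq, not_le]
  constructor
  · rintro ⟨⟨h1, h2⟩, hx⟩; exact ⟨by omega, hx⟩
  · rintro ⟨h, hx⟩; exact ⟨⟨by omega, by omega⟩, hx⟩

/-- **FREE-COORDINATE IDENTITY FOR A THRESHOLD SLOT.**  `e ∉ F`, `A` and `B` independent of `e` (sections equal to themselves),
`σ = μ{N_F = t}`:  `n_{N_{insert e F} ≥ t+1}(A,B) = p_e·n_{N_F ≥ t}(A,B) + q_e·n_{N_F ≥ t+1}(A,B) + p_e q_e·[σ·μ(A∩B∩{N_F=t}) − μ(A∩{N_F=t})·μ(B∩{N_F=t})]`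
— the last bracket is `σ²·Cov(1_A, 1_B ∣ N_F = t)`: a counted coordinate that is free for both events costs exactly the layer-conditioned
covariance of the pair (typically negative), paid from the mixture of the two adjacent-level `(2′)` values. [this work] -/
theorem osN_threshold_free_coordinate_eq (p : ι → unitInterval) {F : Finset ι} {e : ι} (he : e ∉ F) (t : ℕ) (A B : Set (Set ι))
    (hA1 : {ω : Set ι | insert e ω ∈ A} = A) (hA0 : {ω : Set ι | ω \ {e} ∈ A} = A)
    (hB1 : {ω : Set ι | insert e ω ∈ B} = B) (hB0 : {ω : Set ι | ω \ {e} ∈ B} = B) :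
    osN p {ω : Set ι | t + 1 ≤ ((insert e F).filter (· ∈ ω)).card} (ind A) (ind B) =
      (p e : ℝ) * osN p {ω : Set ι | t ≤ (F.filter (· ∈ ω)).card} (ind A) (ind B)
        + (1 - p e) * osN p {ω : Set ι | t + 1 ≤ (F.filter (· ∈ ω)).card} (ind A) (ind B)
        + (p e : ℝ) * (1 - p e) *
          ((prodBernoulli p).real {ω : Set ι | (F.filter (· ∈ ω)).card = t} *
              (prodBernoulli p).real ({ω : Set ι | (F.filter (· ∈ ω)).card = t} ∩ A ∩ B)
            - (prodBernoulli p).real ({ω : Set ι | (F.filter (· ∈ ω)).card = t} ∩ A)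
              * (prodBernoulli p).real ({ω : Set ι | (F.filter (· ∈ ω)).card = t} ∩ B)) := by
  have hH : {ω : Set ι | ω \ {e} ∈ {ω : Set ι | t + 1 ≤ ((insert e F).filter (· ∈ ω)).card}} ⊆
      {ω : Set ι | insert e ω ∈ {ω : Set ι | t + 1 ≤ ((insert e F).filter (· ∈ ω)).card}} := by
    rw [section_insert_threshold he t, section_sdiff_threshold he t]
    intro ω hω; simp only [Set.mem_setOf_eq] at hω ⊢; omega
  rw [osN_free_coordinate_eq p _ A B e hA1 hA0 hB1 hB0 hH]
  have b0 := real_section_band_eq_layer p he t (Set.univ : Set (Set ι))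
  have bAB := real_section_band_eq_layer p he t (A ∩ B)
  have bA := real_section_band_eq_layer p he t A
  have bB := real_section_band_eq_layer p he t B
  simp only [Set.inter_univ] at b0
  rw [Set.inter_assoc, bAB, bA, bB, b0, section_insert_threshold he t, section_sdiff_threshold he t, ← Set.inter_assoc]

end SahiOneStep

end Summit.CriticalPhenomena.PercolationContinuityZ3.Theorems
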